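import Mathlib
import Literature.Computability.AlgebraicComplexity.DepthThreeRankBound
import Summits.ValiantsHypothesis.ValiantsHypothesis.Theorems.MonotoneRestorationMixingScaleOrbitDatum
import Summits.ValiantsHypothesis.ValiantsHypothesis.Theorems.MonotoneRestorationMixingScaleEssStableAlt
import Summits.ValiantsHypothesis.ValiantsHypothesis.Theorems.MonotoneRestorationMixingScaleSpanOneUAlt
import HarnessLib

/-!
# M4c of the line `mixing-scale`, II: non-linear parts in `U`, sign characters, GLOBAL UNTWISTING, Theorem S′ at a level (ORBIT currency)

Route MonotoneRestoration, crux `OrbitRestorationQP` (stmt-ValiantsHypothesis-18293), line `mixing-scale` (val-idea-12), registered stub **M4c**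
`stub_polyScaleStructure` (Theorem S′).  Namespace `Summit.ValiantsHypothesis.ValiantsHypothesis.Theorems.OrbitRestorationQPMixingScale.OrbitDatum`.

Port of `…LevelStructureA.exists_aeval_U` and `…LevelStructureC.lean` to the orbit datum (`…MixingScaleOrbitDatum.lean`: no separation, even-
invariant class sums), with the second repair of the design note `Cruxes/OrbitRestorationQP/Lines/mixing-scale-M4c-design-ms1.md`:

* `exists_aeval_U` — the non-linear part of every nonzero class sum is `Q(U)`: the essential space `E` is even-stable and small (M4a
  `essStableAlt`), hence inside `span(1, U)` by M4b `spanOneUAlt` (threshold `4·dim E + 8 ≤ n`), so `ℂ[ess] ⊆ ℂ[U]`;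
* `exists_rowChar` / `exists_colChar` — rows / columns act on `Π linPart(F_a)` through multiplicative scalars `χ` (from part I's
  `exists_C_mul_linProd` with `Fall4`), hence `χ ∈ {±1}`; `mact_F_eq_C_mul` — `mact σ τ F_a = χr(σ)χc(τ)·F_a`;
* (G2) **GLOBAL UNTWISTING BY MINIMALITY** (`mact_row_F`, `mact_col_F`, `mact_F`): applying a row permutation `σ` to the FULLY symmetric
  `f = Σ_b F_b` gives `Σ_b F_b = Σ_b χ_b F_b`, so the class sums with `χ_b = −1` add up to zero — a vanishing sub-sum of the minimal
  representation over the union of their fibres — so there are none: EVERY `(σ, τ)` fixes EVERY class sum (replacing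
  `LevelStructureC.not_mact_eq_neg`, which used that arbitrary renamings permute SEPARATED cluster sums);
* `mact_linProd` — hence every `Π linPart(F_a)` is fixed by the whole matrix action; `structure_level` — **THEOREM S′ AT A LEVEL**:
  `f = Σ_a u_a · Π Lin_a · Q_a(U)` with matrix-symmetric affine products `Π Lin_a` of `≤ D` factors and univariate `Q_a`.

Side conditions `Hyps c`: `4·m·D < C(n, c+2)`, `4(c+2) ≤ n`, `c + 7 ≤ n`, `4·m(1 + m²Θ) + 8 ≤ n`.  Everything is proved (no named fact
is used in this file).  Honest framing: part of one L-sized input of a tier-B rung; nothing here bears on VP ≠ VNP.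
[cite: KarninShpilka2009, §3; SaxenaSeshadhri2013, Theorem 5]
-/

noncomputable section

open MvPolynomial Equiv Literature.Computability.AlgebraicComplexity

-- `Summit.ValiantsHypothesis.ValiantsHypothesis.…` is the tree's single-conjunct layout (Sub = Summit).
set_option linter.dupNamespace false

namespace Summit.ValiantsHypothesis.ValiantsHypothesis.Theorems.OrbitRestorationQPMixingScale

open RankDistance LinNL LinearSubalgebra ProductAction LevelRep LevelStructure

variable {n : ℕ}

namespace OrbitDatum

variable {D : ℕ} (O : OrbitDatum n D)

/-- The numerical side conditions of Theorem S′ at a level, for the exponent `c`. [folklore] -/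
structure Hyps (c : ℕ) : Prop where
  hc1 : 4 * (O.R.m * D) < n.choose (c + 2)
  hc2 : 4 * (c + 2) ≤ n
  hc3 : c + 7 ≤ n
  hdim : 4 * (O.R.m * (1 + O.R.m ^ 2 * O.Θ)) + 8 ≤ n

/-- The product of the linear factors of the class sum of `a`. [folklore] -/
def linProd (a : Fin O.R.m) : MvPolynomial (Fin n × Fin n) ℂ := (linPart (O.F a)).prod

/-- `linProd a ≠ 0`. [folklore] -/
theorem linProd_ne_zero (a : Fin O.R.m) : O.linProd a ≠ 0 := by
  rw [linProd, Ne, Multiset.prod_eq_zero_iff]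
  intro h
  have := totalDegree_of_mem_linPart h
  rw [totalDegree_zero] at this
  exact zero_ne_one this

/-! ### The non-linear parts are polynomials in `U` (M4a + M4b) -/

/-- **THE NON-LINEAR PARTS ARE POLYNOMIALS IN `U`**: under `4m(1 + m²Θ) + 8 ≤ n`, for every label with nonzero class sum,
`nlPart (F a) = Q(U)` for a univariate `Q`, and it is fixed by the matrix action. [cite: KarninShpilka2009, §3] -/
theorem exists_aeval_U (hdim : 4 * (O.R.m * (1 + O.R.m ^ 2 * O.Θ)) + 8 ≤ n) {a : Fin O.R.m} (ha : a ∈ O.labs) :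
    ∃ Q : Polynomial ℂ, nlPart (O.F a) = Polynomial.aeval (U n) Q ∧
      ∀ σ τ : Perm (Fin n), mact σ τ (nlPart (O.F a)) = nlPart (O.F a) := by
  classical
  -- the essential space of the nonzero class sums (M4a)
  set E : Submodule ℂ (MvPolynomial (Fin n × Fin n) ℂ) :=
    (Finset.univ.filter fun a => O.R.clusterSum O.cl a ≠ 0).sup fun a => ess (nlPart (O.R.clusterSum O.cl a)) with hE
  obtain ⟨hstab, hfin, hfr⟩ := essStableAlt n D O.f O.R O.cl O.Θ O.hdiam O.hfix
  rw [← hE] at hstab hfin hfr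
  haveI := hfin
  have hdimE : 4 * Module.finrank ℂ E + 8 ≤ n := by
    have : 4 * Module.finrank ℂ E ≤ 4 * (O.R.m * (1 + O.R.m ^ 2 * O.Θ)) := Nat.mul_le_mul_left 4 hfr
    omega
  have hEdeg : E ≤ deg1 ℂ (Fin n × Fin n) := by
    rw [hE]
    exact Finset.sup_le fun b _ => (admissible_ess _).1
  have haF : a ∈ Finset.univ.filter fun a => O.R.clusterSum O.cl a ≠ 0 := Finset.mem_filter.2 ⟨Finset.mem_univ _, O.F_ne_zero ha⟩
  have hle : ess (nlPart (O.F a)) ≤ E := by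
    rw [hE]
    exact Finset.le_sup (f := fun a => ess (nlPart (O.R.clusterSum O.cl a))) haF
  -- `E ⊆ span(1, U)` (M4b)
  have hess : ∀ w ∈ ess (nlPart (O.F a)), w ∈ Submodule.span ℂ ({C 1, U n} : Set (MvPolynomial (Fin n × Fin n) ℂ)) :=
    fun w hw => spanOneUAlt n O.hn8 E hEdeg hstab hdimE w (hle hw)
  have h2 : Algebra.adjoin ℂ (ess (nlPart (O.F a)) : Set (MvPolynomial (Fin n × Fin n) ℂ)) ≤ Algebra.adjoin ℂ {U n} := by
    refine Algebra.adjoin_le fun w hw => ?_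
    obtain ⟨x, y, hxy⟩ := Submodule.mem_span_pair.1 (hess w hw)
    rw [← hxy, smul_eq_C_mul, smul_eq_C_mul, C_1, mul_one]
    exact Subalgebra.add_mem _ (Subalgebra.algebraMap_mem _ x)
      (Subalgebra.mul_mem _ (Subalgebra.algebraMap_mem _ y) (Algebra.subset_adjoin (Set.mem_singleton _)))
  have hmem : nlPart (O.F a) ∈ (Polynomial.aeval (U n) : Polynomial ℂ →ₐ[ℂ] _).range := by
    rw [← Algebra.adjoin_singleton_eq_range_aeval]
    exact h2 (mem_adjoin_ess (nlPart (O.F a)))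
  obtain ⟨Q, hQ⟩ := hmem
  have hQ' : Polynomial.aeval (U n) Q = nlPart (O.F a) := hQ
  refine ⟨Q, hQ'.symm, fun σ τ => ?_⟩
  rw [← hQ', ← AlgHom.coe_coe, ← Polynomial.aeval_algHom_apply, AlgHom.coe_coe, mact_U]

/-! ### The sign characters -/

/-- The row scalars form a multiplicative character. [folklore] -/
theorem exists_rowChar {c : ℕ} (hH : O.Hyps c) {a : Fin O.R.m} (ha : a ∈ O.labs) :
    ∃ χ : Perm (Fin n) → ℂ, (∀ σ, vact (K := ℂ) rowHom σ (O.linProd a) = C (χ σ) * O.linProd a) ∧ χ 1 = 1 ∧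
      (∀ σ σ', χ (σ * σ') = χ σ * χ σ') := by
  choose χ hχ0 hχ1 using fun σ => O.exists_C_mul_linProd isLocal_rowHom O.rowFix_F O.row_Fall4 hH.hc1 hH.hc2 hH.hc3 ha σ
  have hχ : ∀ σ, vact (K := ℂ) rowHom σ (O.linProd a) = C (χ σ) * O.linProd a := fun σ => hχ1 σ
  have hne := O.linProd_ne_zero a
  refine ⟨χ, hχ, ?_, fun σ σ' => ?_⟩
  · have h := hχ 1
    rw [map_one, AlgEquiv.one_apply] at h
    have : C (χ 1) * O.linProd a = C 1 * O.linProd a := by rw [← h, C_1, one_mul]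
    exact C_injective _ _ (mul_right_cancel₀ hne this)
  · have hC : ∀ (ρ : Perm (Fin n)) (t : ℂ), vact (K := ℂ) rowHom ρ (C t) = C t := fun ρ t => by simp [vact_apply]
    have h1 : vact (K := ℂ) rowHom (σ * σ') (O.linProd a) = C (χ σ * χ σ') * O.linProd a := by
      rw [map_mul, AlgEquiv.mul_apply, hχ σ', map_mul, hC, hχ σ, map_mul]; ring
    rw [hχ (σ * σ')] at h1
    exact C_injective _ _ (mul_right_cancel₀ hne h1)

/-- The column scalars form a multiplicative character. [folklore] -/
theorem exists_colChar {c : ℕ} (hH : O.Hyps c) {a : Fin O.R.m} (ha : a ∈ O.labs) :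
    ∃ χ : Perm (Fin n) → ℂ, (∀ τ, vact (K := ℂ) colHom τ (O.linProd a) = C (χ τ) * O.linProd a) ∧ χ 1 = 1 ∧
      (∀ τ τ', χ (τ * τ') = χ τ * χ τ') := by
  choose χ hχ0 hχ1 using fun τ => O.exists_C_mul_linProd isLocal_colHom O.colFix_F O.col_Fall4 hH.hc1 hH.hc2 hH.hc3 ha τ
  have hχ : ∀ τ, vact (K := ℂ) colHom τ (O.linProd a) = C (χ τ) * O.linProd a := fun τ => hχ1 τ
  have hne := O.linProd_ne_zero a
  refine ⟨χ, hχ, ?_, fun τ τ' => ?_⟩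
  · have h := hχ 1
    rw [map_one, AlgEquiv.one_apply] at h
    have : C (χ 1) * O.linProd a = C 1 * O.linProd a := by rw [← h, C_1, one_mul]
    exact C_injective _ _ (mul_right_cancel₀ hne this)
  · have hC : ∀ (ρ : Perm (Fin n)) (t : ℂ), vact (K := ℂ) colHom ρ (C t) = C t := fun ρ t => by simp [vact_apply]
    have h1 : vact (K := ℂ) colHom (τ * τ') (O.linProd a) = C (χ τ * χ τ') * O.linProd a := by
      rw [map_mul, AlgEquiv.mul_apply, hχ τ', map_mul, hC, hχ τ, map_mul]; ring
    rw [hχ (τ * τ')] at h1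
    exact C_injective _ _ (mul_right_cancel₀ hne h1)

/-- **Every renaming multiplies a nonzero class sum by a SIGN**: `mact σ τ (F a) = ε · F a` with `ε ∈ {1, −1}`. [folklore] -/
theorem exists_sign_mact_F {c : ℕ} (hH : O.Hyps c) {a : Fin O.R.m} (ha : a ∈ O.labs) (σ τ : Perm (Fin n)) :
    ∃ ε : ℂ, (ε = 1 ∨ ε = -1) ∧ mact σ τ (O.F a) = C ε * O.F a ∧ mact σ τ (O.linProd a) = C ε * O.linProd a := by
  obtain ⟨χr, hχr, hχr1, hχrm⟩ := O.exists_rowChar hH ha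
  obtain ⟨χc, hχc, hχc1, hχcm⟩ := O.exists_colChar hH ha
  obtain ⟨Q, hQ, hQfix⟩ := O.exists_aeval_U hH.hdim ha
  obtain ⟨u, hu, hFe⟩ := exists_eq_C_mul (O.F_ne_zero ha)
  have hCrow : ∀ (ρ : Perm (Fin n)) (t : ℂ), vact (K := ℂ) rowHom ρ (C t) = C t := fun ρ t => by simp [vact_apply]
  have hCcol : ∀ (ρ : Perm (Fin n)) (t : ℂ), vact (K := ℂ) colHom ρ (C t) = C t := fun ρ t => by simp [vact_apply]
  have hlin : mact σ τ (O.linProd a) = C (χr σ * χc τ) * O.linProd a := by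
    rw [mact, AlgEquiv.trans_apply, hχc, map_mul, hCrow, hχr, map_mul]; ring
  have hact : mact σ τ (O.F a) = C (χr σ * χc τ) * O.F a := by
    have hnl : mact σ τ (nlPart (O.F a)) = nlPart (O.F a) := hQfix σ τ
    conv_lhs => rw [hFe]
    rw [map_mul, map_mul]
    have hC : mact σ τ (C u) = C u := by rw [mact, AlgEquiv.trans_apply, hCcol, hCrow]
    rw [hC, hnl]
    change C u * (mact σ τ (O.linProd a) * nlPart (O.F a)) = _
    rw [hlin]
    conv_rhs => rw [hFe]
    change _ = C (χr σ * χc τ) * (C u * (O.linProd a * nlPart (O.F a)))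
    ring
  have hε : χr σ * χc τ = 1 ∨ χr σ * χc τ = -1 := by
    rcases eq_one_or_eq_neg_one χr hχr1 hχrm σ with h1 | h1 <;> rcases eq_one_or_eq_neg_one χc hχc1 hχcm τ with h2 | h2 <;>
      simp [h1, h2]
  exact ⟨χr σ * χc τ, hε, hact, hlin⟩

/-! ### Global untwisting by minimality -/

/-- **GLOBAL UNTWISTING**: every renaming fixes every class sum.  (The class sums moved to their negatives add up to a vanishing sub-sum of
the minimal representation, because `f` itself is fixed.) [folklore] -/
theorem mact_F {c : ℕ} (hH : O.Hyps c) (σ τ : Perm (Fin n)) (a : Fin O.R.m) : mact σ τ (O.F a) = O.F a := by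
  classical
  by_cases ha : a ∈ O.labs
  swap
  · rw [O.F_eq_zero_of_not_mem ha, map_zero]
  -- signs for every label
  have key : ∀ b : Fin O.R.m, ∃ ε : ℂ, (ε = 1 ∨ ε = -1) ∧ mact σ τ (O.F b) = C ε * O.F b := by
    intro b
    by_cases hb : b ∈ O.labs
    · obtain ⟨ε, hε, h, -⟩ := O.exists_sign_mact_F hH hb σ τ
      exact ⟨ε, hε, h⟩
    · exact ⟨1, Or.inl rfl, by rw [O.F_eq_zero_of_not_mem hb, map_zero, mul_zero]⟩
  choose ε hε hmact using key
  -- the labels moved to their negatives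
  set B : Finset (Fin O.R.m) := O.labs.filter fun b => ε b = -1 with hB
  -- their class sums add up to zero
  have hsum : ∑ b ∈ B, O.F b = 0 := by
    have hf : ∑ b ∈ O.labs, O.F b = ∑ b ∈ O.labs, C (ε b) * O.F b := by
      conv_lhs => rw [O.sum_F, ← O.hsym σ τ, ← O.sum_F, map_sum]
      exact Finset.sum_congr rfl fun b _ => hmact b
    have hdiff : ∑ b ∈ O.labs, (O.F b - C (ε b) * O.F b) = 0 := by rw [Finset.sum_sub_distrib, ← hf, sub_self]
    have hsplit : ∑ b ∈ O.labs, (O.F b - C (ε b) * O.F b) = ∑ b ∈ B, (2 : ℂ) • O.F b := by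
      rw [hB, Finset.sum_filter]
      refine Finset.sum_congr rfl fun b _ => ?_
      rcases hε b with h | h
      · rw [h, C_1, one_mul, sub_self, if_neg (by norm_num)]
      · rw [if_pos h, h, map_neg, C_1, two_smul]; ring
    rw [hsplit, ← Finset.smul_sum] at hdiff
    exact (smul_eq_zero.1 hdiff).resolve_left two_ne_zero
  -- which is a sub-sum of the minimal representation over the union of the fibres of `B`
  have hI : ∑ b ∈ B, O.F b = ∑ i ∈ Finset.univ.filter (fun i => O.cl i ∈ B), O.R.T i := by
    have h := Finset.sum_fiberwise_of_maps_to (s := Finset.univ.filter fun i : Fin O.R.m => O.cl i ∈ B) (t := B) (g := O.cl)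
      (fun i hi => (Finset.mem_filter.1 hi).2) (f := fun i => O.R.T i)
    rw [← h]
    refine Finset.sum_congr rfl fun b hb => ?_
    unfold F CleanRep.clusterSum
    refine Finset.sum_congr ?_ fun _ _ => rfl
    ext i
    simp only [Finset.mem_filter, Finset.mem_univ, true_and]
    constructor
    · intro h; exact ⟨by rw [h]; exact hb, h⟩
    · intro h; exact h.2
  have hBempty : B = ∅ := by
    by_contra hne
    obtain ⟨b, hb⟩ := Finset.nonempty_iff_ne_empty.2 hne
    have hbl : b ∈ O.labs := (Finset.mem_filter.1 hb).1
    obtain ⟨i, hi⟩ := O.fibre_nonempty hbl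
    have hiI : i ∈ Finset.univ.filter (fun i => O.cl i ∈ B) := by
      simp only [fibre, Finset.mem_filter, Finset.mem_univ, true_and] at hi
      exact Finset.mem_filter.2 ⟨Finset.mem_univ _, by rw [hi]; exact hb⟩
    refine O.R.hmin _ ⟨i, hiI⟩ ?_
    have := hsum
    rw [hI] at this
    exact this
  -- so `ε a = 1`
  have hεa : ε a = 1 := by
    rcases hε a with h | h
    · exact h
    · exfalso
      have : a ∈ B := Finset.mem_filter.2 ⟨ha, h⟩
      rw [hBempty] at this
      exact Finset.notMem_empty a this
  rw [hmact a, hεa, C_1, one_mul]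

/-- **`Π linPart (F_a)` is fixed by the whole matrix action.** [folklore] -/
theorem mact_linProd {c : ℕ} (hH : O.Hyps c) {a : Fin O.R.m} (ha : a ∈ O.labs) (σ τ : Perm (Fin n)) :
    mact σ τ (O.linProd a) = O.linProd a := by
  obtain ⟨ε, -, hF, hlin⟩ := O.exists_sign_mact_F hH ha σ τ
  have h1 : C ε * O.F a = C 1 * O.F a := by rw [← hF, O.mact_F hH σ τ a, C_1, one_mul]
  have hε : ε = 1 := C_injective _ _ (mul_right_cancel₀ (O.F_ne_zero ha) h1)
  rw [hlin, hε, C_1, one_mul]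

/-! ### Theorem S′ at a level -/

/-- **THEOREM S′ AT A LEVEL.**  Under the side conditions `Hyps c`, a matrix-symmetric `f` with a clean minimal representation and a labelling
of plain diameter `Θ` with even-invariant class sums decomposes as `f = Σ_a u_a · Π Lin_a · Q_a(U)`: each `Π Lin_a` is a product of at most
`D` polynomials of degree `1` FIXED by the whole matrix action, `Q_a` is univariate, `U = Σ x_{pq}`. [cite: KarninShpilka2009, §3] -/
theorem structure_level {c : ℕ} (hH : O.Hyps c) :
    ∃ (u : Fin O.R.m → ℂ) (Lin : Fin O.R.m → Multiset (MvPolynomial (Fin n × Fin n) ℂ)) (Q : Fin O.R.m → Polynomial ℂ),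
      (∀ a, ∀ q ∈ Lin a, q.totalDegree = 1) ∧ (∀ a, Multiset.card (Lin a) ≤ D) ∧
      (∀ a (σ τ : Perm (Fin n)), mact σ τ (Lin a).prod = (Lin a).prod) ∧
      O.f = ∑ a, C (u a) * (Lin a).prod * Polynomial.aeval (U n) (Q a) := by
  classical
  have hdata : ∀ a, ∃ (u : ℂ) (Lin : Multiset (MvPolynomial (Fin n × Fin n) ℂ)) (Q : Polynomial ℂ),
      (∀ q ∈ Lin, q.totalDegree = 1) ∧ Multiset.card Lin ≤ D ∧ (∀ σ τ : Perm (Fin n), mact σ τ Lin.prod = Lin.prod) ∧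
      O.F a = C u * Lin.prod * Polynomial.aeval (U n) Q := by
    intro a
    by_cases ha : a ∈ O.labs
    · obtain ⟨Q, hQ, -⟩ := O.exists_aeval_U hH.hdim ha
      obtain ⟨u, -, hFe⟩ := exists_eq_C_mul (O.F_ne_zero ha)
      refine ⟨u, linPart (O.F a), Q, fun q hq => totalDegree_of_mem_linPart hq,
        (card_linPart_le (O.F_ne_zero ha)).trans (O.totalDegree_F_le a), fun σ τ => O.mact_linProd hH ha σ τ, ?_⟩
      rw [← hQ, mul_assoc]; exact hFe
    · refine ⟨0, 0, 0, by simp, by simp, fun σ τ => by simp, ?_⟩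
      rw [C_0, zero_mul, zero_mul]
      exact O.F_eq_zero_of_not_mem ha
  choose u Lin Q h1 h2 h3 h4 using hdata
  refine ⟨u, Lin, Q, h1, h2, h3, ?_⟩
  have h := O.R.sum_clusterSum O.cl
  calc O.f = ∑ a, O.R.clusterSum O.cl a := h.symm
    _ = _ := Finset.sum_congr rfl fun a _ => h4 a

end OrbitDatum

end Summit.ValiantsHypothesis.ValiantsHypothesis.Theorems.OrbitRestorationQPMixingScale

end
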